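import Literature.AlgebraicGeometry.HodgeTheory.RibetTypeOnePowersHodgeClasses
import Literature.AlgebraicGeometry.Motives.HodgeThetaSubalgebraUnitaryThreeCoprime
import HarnessLib

/-!
# Hodge classes on all powers of an abelian variety of dimension `g`, `3 ∤ g`, of Ribet type `(3, g − 3)` are generated by divisor classes — UNCONDITIONAL
# (Ribet 1983, Thm. 3 at the coprime pairs `(3, g − 3)`, `3 ∤ g`; Moonen–Zarhin 1999 §2 (2.4) Type IV(1); the sevenfold signatures `(3,4)`/`(4,3)`)

Family `hodge`, layer `Literature/AlgebraicGeometry/HodgeTheory`. Research context: cell `pub-hodge-ring2` (HONEST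
FRAMING: research route conditional on HC_CM; not a corollary; Q11.4-sentence-2 already refuted in dim ≥ 3),
Literature lane (lit gen 83, programme R62). UNCONDITIONAL for the class of abelian varieties it names; theorems only, no
definition, no named fact (D-0026), no `sorry`. This file is the `(3, g − 3)` twin of `RibetTypeTwoOddPowersHodgeClasses`
(`(2, g − 2)`, `g` odd), `RibetTypeTwoThreePowersHodgeClasses` (`g = 5`) and `RibetTypeOnePowersHodgeClasses` (type `(m,1)`):
the invariance theorem, the unipotent-bridge assembly and the geometric corollaries are the SAME text with THEOREM L⁗
(`Motives/HodgeThetaSubalgebraUnitaryThreeCoprime`, resting on the classification-free Hermitian core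
`Motives/HodgeThetaSubalgebraUnitaryThreeCoprimeCore`) in place of THEOREM L‴, and the multiplicity hypothesis
`{dim W^{1,0}, dim W^{0,1}} = {3, b}`, `3 ∤ b`, in place of `{2, b}`, `b` odd.

THE PRINT. Ribet 1983, Thm. 3 (Gordon's survey, Thm. 6.3 (3)): «`End⁰(A)` is an imaginary quadratic field `K`, and
the multiplicities `n′` and `n″` … are relatively prime. Then `Hg(A) = Lf(A)` and thus `Hdg(Aⁿ) = Div(Aⁿ)` for
`n ≥ 1`.» Here `(n′, n″) = (3, g − 3)` or `(g − 3, 3)` with `3 ∤ g = dim A` (so `gcd = 1`); for `g = 7` these are the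
signatures `(3,4)`, `(4,3)` of the simple abelian sevenfolds of Type IV(1) (Moonen–Zarhin (2.7): prime dimension) — the
last unitary signatures of dimension `7`.

PROVED HERE: `AVSlots.exists_unitaryInvariant_coeff_threeCoprime`, `AVSlots.unitaryHodgeClasses_divisorial_threeCoprime`,
`AVSlots.isDivisorGenerated_of_unitaryData_threeCoprime` (ports), **`AVSlots.isDivisorGenerated_of_ribetTypeThreeCoprime`**
(`B = D` on every abelian variety with slots over an `A` with `3 ∤ dim A`, `φ ≫ φ = −d`, `dim_ℚ End⁰(A) = 2`, one
multiplicity equal to `3`), **`AbelianVariety.isDivisorGenerated_powSucc_of_ribetTypeThreeCoprime`** (all powers),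
`AbelianVariety.isDivisorGenerated_of_ribetTypeThreeCoprime`, `hodgeConjectureFor_powSucc_of_ribetTypeThreeCoprime`, and
the dimension-`7` cells `AbelianVariety.isDivisorGenerated_powSucc_of_sevenfold_threeFour`,
`hodgeConjectureFor_powSucc_of_sevenfold_threeFour` (signatures `(3,4)` / `(4,3)`). The conclusion of the named fact
`Ribet1983_hodgeClasses_divisorial_powers_imaginaryQuadraticCoprime` is thereby a THEOREM for every `g` with `3 ∤ g` at
multiplicities `(3, g − 3)`; in particular for EVERY signature of dimension `7`.

## References
* [Ribet1983] K. A. Ribet, Amer. J. Math. 105 (1983), Thm. 0 and Thm. 3.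
* [Gordon1997] B. B. Gordon, *A survey of the Hodge conjecture for abelian varieties*, Thm. 6.3 (3) and §6 (pp. 18–19).
* [MoonenZarhin1999LowDim] B. Moonen, Yu. Zarhin, Math. Ann. 315 (1999), §2 (2.4), Thm. (2.7), §3 (3.1).
* [Milne1999LefschetzClasses] J. S. Milne, Duke Math. J. 96 (1999), Prop. 3.3, Prop. 3.6 (c), Remark 3.7.
* [GoodmanWallachGTM255] R. Goodman, N. Wallach, GTM 255, Thm. 2.2.2 and Thm. 5.3.1.
* [vanGeemen1994HodgeAV] B. van Geemen, LNM 1594 (1994), §2.4, Lemma 3.7.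
* [Deligne2000] P. Deligne, *The Hodge conjecture* (Clay, 2000), §1.
-/

noncomputable section

open scoped TensorProduct
open scoped Matrix
open CategoryTheory Module

namespace Literature.AlgebraicGeometry.HodgeTheory

open Literature.AlgebraicTopology.SingularHomology
open Literature.AlgebraicGeometry.Motives (IsSmoothProjective AbelianVariety bettiCohomology
  ofRatClassBaseChange ofRatClassBaseChange_tmul HodgeTensorFacts hodgeTensorFacts_holds)
open Literature.Barriers.HodgeConjecture
open Literature.AlgebraicGeometry.Motives.HodgeStructure
open Literature.RepresentationTheory.GeneralLinear
open Literature.RepresentationTheory.ClassicalInvariants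
open Literature.NumberTheory.DiophantineGeometry
open Literature.AlgebraicGeometry.ComplexMultiplication (bettiRep_of)

section Invariance

variable {A B : AbelianVariety ℂ} {n : ℕ} {g : Fin n → (B ⟶ A)}

/-- The two elements of `Fin 2`. [folklore] -/
private theorem fin2_cases' (r : Fin 2) : r = 0 ∨ r = 1 := by
  fin_cases r <;> simp

open scoped Classical in
/-- **THE INVARIANCE THEOREM at multiplicities `(3, b)`, `3 ∤ b` (Ribet 1983 Thm. 3, Lie step, for abelian varieties with
slots over `A` of unitary type `(3, b)`)** — verbatim the tree's `AVSlots.exists_unitaryInvariant_coeff` (type `(m,1)`)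
with THEOREM L⁗ (`UnitaryThetaThreeCoprime.wordDerAt_eq_zero_of_commute_of_skew`) in place of THEOREM L′: every rational
`(p,p)`-class on `B` is `∑_w a(w)·(g e, g f)_w` for a coefficient function `a` on slot-and-type words whose slices
are killed by the typed differential of EVERY `X ∈ 𝔤𝔩_{n₀}(ℂ)` (`X` on the `W`-letters, `−Xᵀ` on the `W'`-letters).
Gordon: «the induced map `MT(A, ℂ) → GL(W')` is surjective». [cite: Ribet1983, Thm. 3]
[cite: Gordon1997, §6 (proof of Thm. 6.3.3, pp. 18–19)] [cite: MoonenZarhin1999LowDim, §2 (2.4) and §3 (3.1)] -/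
theorem AVSlots.exists_unitaryInvariant_coeff_threeCoprime [HodgeTensorFacts.{0, 0}] (hg : AVSlots A B g)
    (hHD : exists_isReal_hodgeModel) (hI : hodgePQ_independent_of_hodgeModel)
    (ψ : (BettiUniverse.hodge hHD (AbelianVariety.isSmoothProjective_holds (A := A)) 1).Polarization)
    {φ : Module.End ℚ (bettiCohomology A.X 1)}
    (hφE : φ ∈ (BettiUniverse.hodge hHD (AbelianVariety.isSmoothProjective_holds (A := A)) 1).endAlg)
    {d : ℚ} (hd : 0 < d) (hφ2 : φ * φ = -(d • 1))
    (hE : ∀ a ∈ (BettiUniverse.hodge hHD (AbelianVariety.isSmoothProjective_holds (A := A)) 1).endAlg,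
      ∃ x y : ℚ, a = x • 1 + y • φ)
    {μ : ℂ} (hμ : μ ^ 2 = -(d : ℂ))
    (h3b : (Module.finrank ℂ ↥(Module.End.eigenspace (φ.baseChange ℂ) μ ⊓
        (BettiUniverse.hodge hHD (AbelianVariety.isSmoothProjective_holds (A := A)) 1).piece 1 0) = 3 ∧
      ¬ 3 ∣ Module.finrank ℂ ↥(Module.End.eigenspace (φ.baseChange ℂ) μ ⊓
        (BettiUniverse.hodge hHD (AbelianVariety.isSmoothProjective_holds (A := A)) 1).piece 0 1)) ∨
      (¬ 3 ∣ Module.finrank ℂ ↥(Module.End.eigenspace (φ.baseChange ℂ) μ ⊓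
        (BettiUniverse.hodge hHD (AbelianVariety.isSmoothProjective_holds (A := A)) 1).piece 1 0) ∧
      Module.finrank ℂ ↥(Module.End.eigenspace (φ.baseChange ℂ) μ ⊓
        (BettiUniverse.hodge hHD (AbelianVariety.isSmoothProjective_holds (A := A)) 1).piece 0 1) = 3))
    {n₀ : ℕ} (cb : Module.Basis (Fin 2 × Fin n₀) ℂ (ℂ ⊗[ℚ] bettiCohomology A.X 1)) (κ : Fin n₀ → Fin 2)
    (hcbW : ∀ ℓ, cb (0, ℓ) ∈ Module.End.eigenspace (φ.baseChange ℂ) μ)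
    (hcbW' : ∀ ℓ, cb (1, ℓ) ∈ Module.End.eigenspace (φ.baseChange ℂ) (-μ))
    (hcb0 : ∀ ℓ, κ ℓ = 0 →
      cb (0, ℓ) ∈ (BettiUniverse.hodge hHD (AbelianVariety.isSmoothProjective_holds (A := A)) 1).piece 1 0 ∧
      cb (1, ℓ) ∈ (BettiUniverse.hodge hHD (AbelianVariety.isSmoothProjective_holds (A := A)) 1).piece 0 1)
    (hcb1 : ∀ ℓ, κ ℓ = 1 →
      cb (0, ℓ) ∈ (BettiUniverse.hodge hHD (AbelianVariety.isSmoothProjective_holds (A := A)) 1).piece 0 1 ∧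
      cb (1, ℓ) ∈ (BettiUniverse.hodge hHD (AbelianVariety.isSmoothProjective_holds (A := A)) 1).piece 1 0)
    (hdual : ∀ i j, ψ.form.baseChange ℂ (cb (0, i)) (cb (1, j)) = if i = j then 1 else 0)
    {p : ℕ} (hp : 0 < p) {c : complexBetti B.X (2 * p)} (hcQ : IsRationalClass c)
    (hc : IsOfHodgeType B.dim B.X (2 * p) p p c) :
    ∃ a : (Fin (2 * p) → (Fin n × Fin 2) × Fin n₀) → ℂ,
      wordEval (cupPowOneAlt ℂ (Motives.ComplexPoints B.X) (2 * p))
        (fun x : (Fin n × Fin 2) × Fin n₀ => avLetters g (fun tl : Fin 2 × Fin n₀ =>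
          ofRatClassBaseChange (Motives.ComplexPoints A.X) 1 (cb tl)) (x.1.1, (x.1.2, x.2))) a = c ∧
      ∀ (U : Fin (2 * p) → Fin n × Fin 2) (X : Matrix (Fin n₀) (Fin n₀) ℂ),
        wordDerAt ℂ (fun t => if (U t).2 = 0 then X else -Xᵀ) (wordSlice a U) = 0 := by
  classical
  -- the setting
  have hX : IsSmoothProjective A.dim A.X := AbelianVariety.isSmoothProjective_holds
  haveI : Module.Finite ℚ (bettiCohomology A.X 1) := finite_bettiCohomology_one A
  have hn1 : (((1 : ℕ) : ℤ)) = 1 := Nat.cast_one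
  have heff := BettiUniverse.hodge_isEffective hHD hX 1
  obtain ⟨hμ0, -⟩ := UnitaryTheta.conj_eq_neg_of_sq hd hμ
  set F := cupPowOneAlt ℂ (Motives.ComplexPoints B.X) (2 * p) with hFdef
  have hFinj : Function.Injective (exteriorPower.alternatingMapLinearEquiv F) :=
    injective_alternatingMapLinearEquiv_cupPowOneAlt B (2 * p)
  -- bases: the adapted basis `cbσ` and the rational basis `eC`, both indexed by `Fin M`
  set eQ := Module.finBasis ℚ (bettiCohomology A.X 1) with heQ
  set eC : Module.Basis (Fin (Module.finrank ℚ (bettiCohomology A.X 1))) ℂ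
    (ℂ ⊗[ℚ] bettiCohomology A.X 1) := Algebra.TensorProduct.basis ℂ eQ with heC
  set φι : Fin (Module.finrank ℚ (bettiCohomology A.X 1)) ≃ Fin 2 × Fin n₀ := eC.indexEquiv cb with hφι
  set cbσ : Module.Basis (Fin (Module.finrank ℚ (bettiCohomology A.X 1))) ℂ
    (ℂ ⊗[ℚ] bettiCohomology A.X 1) := cb.reindex φι.symm with hcbσdef
  have hcbσ : ∀ m, cbσ m = cb (φι m) := fun m => by
    rw [hcbσdef, Module.Basis.reindex_apply, Equiv.symm_symm]
  -- kinds of the adapted letters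
  set κ2 : Fin 2 × Fin n₀ → Fin 2 := fun tl => if tl.1 = 0 then κ tl.2 else (if κ tl.2 = 0 then 1 else 0)
    with hκ2
  have hkind : ∀ tl : Fin 2 × Fin n₀,
      (κ2 tl = 0 → cb tl ∈ (BettiUniverse.hodge hHD (AbelianVariety.isSmoothProjective_holds (A := A)) 1).piece 1 0) ∧
      (κ2 tl = 1 → cb tl ∈ (BettiUniverse.hodge hHD (AbelianVariety.isSmoothProjective_holds (A := A)) 1).piece 0 1) := by
    rintro ⟨t, ℓ⟩
    rcases fin2_cases' t with rfl | rfl <;> rcases fin2_cases' (κ ℓ) with h | h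
    · have hk : κ2 (0, ℓ) = 0 := by simp [hκ2, h]
      rw [hk]
      exact ⟨fun _ => (hcb0 ℓ h).1, fun h' => absurd h' (by decide)⟩
    · have hk : κ2 (0, ℓ) = 1 := by simp [hκ2, h]
      rw [hk]
      exact ⟨fun h' => absurd h' (by decide), fun _ => (hcb1 ℓ h).1⟩
    · have hk : κ2 (1, ℓ) = 1 := by simp [hκ2, h]
      rw [hk]
      exact ⟨fun h' => absurd h' (by decide), fun _ => (hcb0 ℓ h).2⟩
    · have hk : κ2 (1, ℓ) = 0 := by simp [hκ2, h]
      rw [hk]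
      exact ⟨fun _ => (hcb1 ℓ h).2, fun h' => absurd h' (by decide)⟩
  set κ' : Fin (Module.finrank ℚ (bettiCohomology A.X 1)) → Fin 2 := fun m => κ2 (φι m) with hκ'
  -- letters
  set ρ := ofRatClassBaseChangeEquiv hX 1 with hρ
  set v : Module.Basis _ ℂ (complexBetti A.X 1) := cbσ.map ρ with hv
  set eL : Module.Basis _ ℂ (complexBetti A.X 1) := eC.map ρ with heL
  have heLQ : ∀ i, IsRationalClass (eL i) := fun i => by
    rw [heL, Module.Basis.map_apply, heC, Algebra.TensorProduct.basis_apply, hρ,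
      ofRatClassBaseChangeEquiv_apply, ofRatClassBaseChange_tmul, one_smul]
    exact isRationalClass_ofRatClass _
  have hv_apply : ∀ m, v m = ofRatClassBaseChange (Motives.ComplexPoints A.X) 1 (cb (φι m)) := fun m => by
    rw [hv, Module.Basis.map_apply, hcbσ, hρ, ofRatClassBaseChangeEquiv_apply]
  have hv0 : ∀ m, κ' m = 0 → IsOfHodgeType A.dim A.X 1 1 0 (v m) := by
    intro m hm
    rw [hv_apply, ← BettiUniverse.mem_hodge_piece_iff hHD hI hX (k := 1) (p := 1) (q := 0) rfl]
    exact (hkind (φι m)).1 hm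
  have hv1 : ∀ m, κ' m = 1 → IsOfHodgeType A.dim A.X 1 0 1 (v m) := by
    intro m hm
    rw [hv_apply, ← BettiUniverse.mem_hodge_piece_iff hHD hI hX (k := 1) (p := 0) (q := 1) rfl]
    exact (hkind (φι m)).2 hm
  -- (α) an antisymmetric kind-balanced coefficient function in the adapted letters
  obtain ⟨ax, hax_bal, hax_anti, hcax⟩ := hg.exists_antisymm_kindBalanced_wordEval_eq v κ' hv0 hv1 hp hc
  -- the change of letters to the rational letters
  set G : Matrix _ _ ℂ := eC.toMatrix cbσ with hG
  set G' : Matrix _ _ ℂ := cbσ.toMatrix eC with hG'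
  have hG'G : G' * G = 1 := cbσ.toMatrix_mul_toMatrix_flip eC
  have hve : ∀ m, v m = ∑ i, G i m • eL i := fun m => by
    simp only [hv, heL, Module.Basis.map_apply, ← map_smul, ← map_sum]
    congr 1
    exact (eC.sum_toMatrix_smul_self (v := ⇑cbσ) (j := m)).symm
  have hletters : ∀ j m, avLetters g v (j, m) = ∑ i, G i m • avLetters g eL (j, i) :=
    avLetters_baseChange g G hve
  set aE := colourChangeAt (fun _ : Fin n => G) ax with haE
  have haE_anti : IsAntisymm aE := hax_anti.colourChangeAt _
  have hcaE : wordEval F (avLetters g eL) aE = c := by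
    rw [haE, ← wordEval_eq_wordEval_colourChangeAt F (fun _ : Fin n => G) hletters ax, hcax]
  -- rationality of `aE`
  obtain ⟨q, hq⟩ := hg.exists_rat_wordEval_eq eL heLQ hcQ
  obtain ⟨q', -, haEq⟩ := haE_anti.exists_eq_algebraMap_of_wordEval_eq hFinj (hg.letterBasis eL)
    (q := q) (by rw [AVSlots.coe_letterBasis, hcaE, hFdef, hq])
  have hslice_e : ∀ u, wordSlice aE u = wordRepAt ℂ (fun _ : Fin (2 * p) => G) (wordSlice ax u) :=
    fun u => wordSlice_colourChangeAt (fun _ : Fin n => G) ax u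
  -- the Hodge operator `Θ`: `diag(±1)` in the adapted letters
  obtain ⟨Θ, hΘ⟩ := exists_hodgeTheta (BettiUniverse.hodge hHD (AbelianVariety.isSmoothProjective_holds (A := A)) 1)
  obtain ⟨-, -, hΘ10, hΘ01, -⟩ :=
    UnitaryTheta.theta_facts (BettiUniverse.hodge hHD (AbelianVariety.isSmoothProjective_holds (A := A)) 1)
      hn1 heff hΘ
  have hΘb : ∀ m, Θ (cbσ m) = (if κ' m = 0 then (1 : ℂ) else -1) • cbσ m := by
    intro m
    rw [hcbσ]
    rcases fin2_cases' (κ' m) with h0 | h1'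
    · rw [h0, if_pos rfl, one_smul]
      exact hΘ10 _ ((hkind (φι m)).1 h0)
    · rw [h1', if_neg one_ne_zero, neg_one_smul]
      exact hΘ01 _ ((hkind (φι m)).2 h1')
  have hΘcb : LinearMap.toMatrix cbσ cbσ Θ = kindDiag κ' := by
    ext i m
    rw [LinearMap.toMatrix_apply, hΘb, map_smul, Module.Basis.repr_self, Finsupp.smul_apply,
      Finsupp.single_apply, kindDiag, Matrix.diagonal_apply, smul_eq_mul, mul_ite, mul_one, mul_zero]
    by_cases him : i = m
    · subst him; rw [if_pos rfl]
    · rw [if_neg (Ne.symm him), if_neg him]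
  have hJG : LinearMap.toMatrix eC eC Θ * G = G * kindDiag κ' := by
    rw [← hΘcb, hG, linearMap_toMatrix_mul_basis_toMatrix, basis_toMatrix_mul_linearMap_toMatrix]
  have hΘq : ∀ u : Fin (2 * p) → Fin n, wordDerAt ℂ (fun _ : Fin (2 * p) => LinearMap.toMatrix eC eC Θ)
      (wordSlice (fun w => algebraMap ℚ ℂ (q' w)) u) = 0 := by
    intro u
    rw [← haEq, hslice_e]
    refine wordDerAt_wordRepAt_eq_zero_of_mul_eq ℂ (fun _ : Fin (2 * p) => G) (fun _ => hJG) ?_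
    rw [wordDerAt_const]
    exact wordDer_kindDiag_wordSlice_eq_zero κ' hax_bal u
  -- structure of the adapted basis for `ψ_ℂ` and `φ_ℂ`
  set ψC := ψ.form.baseChange ℂ with hψC
  have hφskewC : ∀ x y, ψC (φ.baseChange ℂ x) y + ψC x (φ.baseChange ℂ y) = 0 := by
    haveI : Nontrivial (bettiCohomology A.X 1) := by
      by_contra hV
      rw [not_nontrivial_iff_subsingleton] at hV
      haveI : Subsingleton (ℂ ⊗[ℚ] bettiCohomology A.X 1) := by
        refine ⟨fun x y => ?_⟩
        have h : ∀ z : ℂ ⊗[ℚ] bettiCohomology A.X 1, z = 0 := fun z => by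
          induction z using TensorProduct.induction_on with
          | zero => rfl
          | tmul c' v' => rw [Subsingleton.elim v' 0, TensorProduct.tmul_zero]
          | add a' b' ha hb => rw [ha, hb, add_zero]
        rw [h x, h y]
      have h0 : Module.finrank ℂ ↥(Module.End.eigenspace (φ.baseChange ℂ) μ ⊓
          (BettiUniverse.hodge hHD (AbelianVariety.isSmoothProjective_holds (A := A)) 1).piece 0 1) = 0 :=
        Module.finrank_zero_of_subsingleton
      rcases h3b with ⟨-, hnd⟩ | ⟨-, h3'⟩
      · exact hnd (by rw [h0]; exact dvd_zero 3)
      · omega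
    exact ThetaSubalgebra.formBaseChange_add_eq_zero_of_skew ψ
      (UnitaryTheta.form_apply_add_form_apply_eq_zero _ ψ hφE hd hφ2 hE)
  have hiso0 : ∀ i j, ψC (cb (0, i)) (cb (0, j)) = 0 := fun i j =>
    UnitaryTheta.form_eq_zero_of_mem_eigenspace hφskewC hμ0 (hcbW i) (hcbW j)
  have hiso1 : ∀ i j, ψC (cb (1, i)) (cb (1, j)) = 0 := fun i j =>
    UnitaryTheta.form_eq_zero_of_mem_eigenspace hφskewC (neg_ne_zero.2 hμ0) (hcbW' i) (hcbW' j)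
  have hswap10 : ∀ i j, ψC (cb (1, i)) (cb (0, j)) = -(if j = i then 1 else 0) := fun i j => by
    rw [hψC, ψ.form_baseChange_swap, show (((1 : ℕ) : ℤ)).negOnePow = -1 from Int.negOnePow_one, ← hψC, hdual]
    split_ifs <;> simp
  have hφcb : ∀ t ℓ, φ.baseChange ℂ (cb (t, ℓ)) = (if t = 0 then μ else -μ) • cb (t, ℓ) := by
    intro t ℓ
    rcases fin2_cases' t with rfl | rfl
    · rw [if_pos rfl]; exact Module.End.mem_eigenspace_iff.1 (hcbW ℓ)
    · rw [if_neg one_ne_zero]; exact Module.End.mem_eigenspace_iff.1 (hcbW' ℓ)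
  -- the invariance of every slice under the typed differentials, via THEOREM L′
  have key : ∀ (X : Matrix (Fin n₀) (Fin n₀) ℂ) (u : Fin (2 * p) → Fin n),
      wordDerAt ℂ (fun _ : Fin (2 * p) => blockLiftGen φι (fun t : Fin 2 => if t = 0 then X else -Xᵀ))
        (wordSlice ax u) = 0 := by
    intro X u
    set Nf : Fin 2 → Matrix (Fin n₀) (Fin n₀) ℂ := fun t => if t = 0 then X else -Xᵀ with hNf
    have hNf0 : Nf 0 = X := if_pos rfl
    have hNf1 : Nf 1 = -Xᵀ := if_neg one_ne_zero
    set Y := Matrix.toLin cbσ cbσ (blockLiftGen φι Nf) with hYdef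
    have hYcb : ∀ t ℓ, Y (cb (t, ℓ)) = ∑ r, Nf t r ℓ • cb (t, r) :=
      fun t ℓ => toLin_blockLiftGen_apply φι cbσ (⇑cb) hcbσ Nf t ℓ
    have hYφ : Y * φ.baseChange ℂ = φ.baseChange ℂ * Y := by
      refine cb.ext fun tl => ?_
      obtain ⟨t, ℓ⟩ := tl
      rw [Module.End.mul_apply, Module.End.mul_apply, hφcb, map_smul, hYcb, map_sum, Finset.smul_sum]
      exact Finset.sum_congr rfl fun r _ => by rw [map_smul, hφcb, smul_comm]
    have hYskew : ∀ x y, ψC (Y x) y + ψC x (Y y) = 0 := by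
      have hB : ψC ∘ₗ Y + ψC.compl₂ Y = 0 := by
        refine LinearMap.BilinForm.ext_basis cb fun tk tl => ?_
        obtain ⟨t, k⟩ := tk
        obtain ⟨t', ℓ⟩ := tl
        rw [LinearMap.add_apply, LinearMap.add_apply, LinearMap.comp_apply, LinearMap.compl₂_apply,
          LinearMap.zero_apply, LinearMap.zero_apply, hYcb, hYcb, map_sum, LinearMap.sum_apply, map_sum]
        simp only [map_smul, LinearMap.smul_apply, smul_eq_mul]
        rcases fin2_cases' t with rfl | rfl <;> rcases fin2_cases' t' with rfl | rfl
        · simp [hiso0]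
        · simp [hNf0, hNf1, hdual, Matrix.neg_apply, Matrix.transpose_apply, mul_ite, Finset.sum_ite_eq,
            Finset.sum_ite_eq']
        · simp [hNf0, hNf1, hswap10, Matrix.neg_apply, Matrix.transpose_apply, mul_ite, Finset.sum_ite_eq,
            Finset.sum_ite_eq']
        · simp [hiso1]
      intro x y
      have h := LinearMap.congr_fun (LinearMap.congr_fun hB x) y
      simpa only [LinearMap.add_apply, LinearMap.comp_apply, LinearMap.compl₂_apply, LinearMap.zero_apply]
        using h
    have hL := UnitaryThetaThreeCoprime.wordDerAt_eq_zero_of_commute_of_skew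
      (BettiUniverse.hodge hHD (AbelianVariety.isSmoothProjective_holds (A := A)) 1) hn1 heff ψ hφE hd hφ2 hE
      hμ h3b eQ q' hΘ hΘq hYφ hYskew u
    rw [← haEq, hslice_e] at hL
    have hYG : ∀ _t : Fin (2 * p), LinearMap.toMatrix eC eC Y * G = G * LinearMap.toMatrix cbσ cbσ Y :=
      fun _ => by rw [hG, linearMap_toMatrix_mul_basis_toMatrix, basis_toMatrix_mul_linearMap_toMatrix]
    have hblk : LinearMap.toMatrix cbσ cbσ Y = blockLiftGen φι Nf := by
      rw [hYdef, LinearMap.toMatrix_toLin]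
    have h3 : wordRepAt ℂ (fun _ : Fin (2 * p) => G)
        (wordDerAt ℂ (fun _ : Fin (2 * p) => blockLiftGen φι Nf) (wordSlice ax u)) = 0 := by
      rw [← hblk, wordRepAt_wordDerAt_of_mul_eq ℂ (fun _ : Fin (2 * p) => G) hYG, hL]
    exact wordRepAt_injective ℂ (g := fun _ : Fin (2 * p) => G) (g' := fun _ : Fin (2 * p) => G')
      (funext fun _ => hG'G) (by rw [h3, map_zero])
  -- the coefficient function, refined to slot-and-type colours
  refine ⟨placeRefineGen φι ax, ?_, fun U X => ?_⟩
  · rw [← hcax]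
    have hx : (fun x : (Fin n × Fin 2) × Fin n₀ => avLetters g v (x.1.1, φι.symm (x.1.2, x.2))) =
        fun x => avLetters g (fun tl : Fin 2 × Fin n₀ =>
          ofRatClassBaseChange (Motives.ComplexPoints A.X) 1 (cb tl)) (x.1.1, (x.1.2, x.2)) := by
      funext x
      rw [avLetters_apply, avLetters_apply, hv_apply, Equiv.apply_symm_apply]
    rw [← hx]
    exact wordEval_placeRefineGen F φι (avLetters g v) ax
  · exact wordDerAt_placeRefineGen_eq_zero φι (fun t : Fin 2 => if t = 0 then X else -Xᵀ) (key X) U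

end Invariance

/-! ### §4 The assembly: `Bᵖ(B) ⊆ Dᵖ(B) ⊗ ℂ` by the unipotent bridge, the tensor FFT for `GL(W)` and the crossed classes -/

section Assembly

variable {A B : AbelianVariety ℂ} {n : ℕ} {g : Fin n → (B ⟶ A)}

open scoped Classical in
/-- **`Bᵖ(B) ⊆ Dᵖ(B) ⊗ ℂ` for an abelian variety `B` with slots over `A` of unitary type `(m, 1)`** (data as in
`exists_unitaryInvariant_coeff`), granted that the CROSSED CLASSES `∑_ℓ g_j^* e_ℓ ⌣ g_{j'}^* f_ℓ` of two slots lie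
in `B¹(B) ⊗ ℂ` (`hcross`; Milne Prop. 3.3: the degree-2 invariants of `GL(W)` on `W ⊕ W^∨` are the pairing).
Every rational `(p,p)`-class on `B` is a `ℂ`-combination of products of `p` rational `(1,1)`-classes: the
slices of its coefficient function are killed by `𝔤𝔩(W)` (`exists_unitaryInvariant_coeff`), hence fixed by
`GL(W)` (`ClassicalInvariants.wordRepAt_mixedFamily_eq_self_of_forall_wordDerAt_eq_zero`, Goodman–Wallach
Thm. 2.2.2), hence combinations of complete contractions (tensor FFT for `GL`, Goodman–Wallach Thm. 5.3.1,
`mem_span_contractionTensor_of_forall_wordDerAt_mixedLieFamily_eq_zero`), each of which evaluates on the letters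
to `±` a product of crossed classes (`Milne1999.sum_contractionTensor_smul_eq`, `sum_cupPowOne_glPairWord_mem`:
Milne Prop. 3.6 (c) "each of which is visibly a product of 2-forms"). Gordon 6.3.3: "then `Hg(A) = Lf(A)` and
thus `Hdg(Aⁿ) = Div(Aⁿ)`". [cite: Ribet1983, Thm. 0 and Thm. 3] [cite: Gordon1997, Thm. 6.3 (3) and §6 (pp. 18–19)]
[cite: Milne1999LefschetzClasses, Prop. 3.6 (c) and Remark 3.7 (pp. 655–656)] [cite: GoodmanWallachGTM255, Thm. 2.2.2 and Thm. 5.3.1] -/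
theorem AVSlots.unitaryHodgeClasses_divisorial_threeCoprime [HodgeTensorFacts.{0, 0}] (hg : AVSlots A B g)
    (hHD : exists_isReal_hodgeModel) (hI : hodgePQ_independent_of_hodgeModel)
    (ψ : (BettiUniverse.hodge hHD (AbelianVariety.isSmoothProjective_holds (A := A)) 1).Polarization)
    {φ : Module.End ℚ (bettiCohomology A.X 1)}
    (hφE : φ ∈ (BettiUniverse.hodge hHD (AbelianVariety.isSmoothProjective_holds (A := A)) 1).endAlg)
    {d : ℚ} (hd : 0 < d) (hφ2 : φ * φ = -(d • 1))
    (hE : ∀ a ∈ (BettiUniverse.hodge hHD (AbelianVariety.isSmoothProjective_holds (A := A)) 1).endAlg,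
      ∃ x y : ℚ, a = x • 1 + y • φ)
    {μ : ℂ} (hμ : μ ^ 2 = -(d : ℂ))
    (h3b : (Module.finrank ℂ ↥(Module.End.eigenspace (φ.baseChange ℂ) μ ⊓
        (BettiUniverse.hodge hHD (AbelianVariety.isSmoothProjective_holds (A := A)) 1).piece 1 0) = 3 ∧
      ¬ 3 ∣ Module.finrank ℂ ↥(Module.End.eigenspace (φ.baseChange ℂ) μ ⊓
        (BettiUniverse.hodge hHD (AbelianVariety.isSmoothProjective_holds (A := A)) 1).piece 0 1)) ∨
      (¬ 3 ∣ Module.finrank ℂ ↥(Module.End.eigenspace (φ.baseChange ℂ) μ ⊓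
        (BettiUniverse.hodge hHD (AbelianVariety.isSmoothProjective_holds (A := A)) 1).piece 1 0) ∧
      Module.finrank ℂ ↥(Module.End.eigenspace (φ.baseChange ℂ) μ ⊓
        (BettiUniverse.hodge hHD (AbelianVariety.isSmoothProjective_holds (A := A)) 1).piece 0 1) = 3))
    {n₀ : ℕ} (cb : Module.Basis (Fin 2 × Fin n₀) ℂ (ℂ ⊗[ℚ] bettiCohomology A.X 1)) (κ : Fin n₀ → Fin 2)
    (hcbW : ∀ ℓ, cb (0, ℓ) ∈ Module.End.eigenspace (φ.baseChange ℂ) μ)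
    (hcbW' : ∀ ℓ, cb (1, ℓ) ∈ Module.End.eigenspace (φ.baseChange ℂ) (-μ))
    (hcb0 : ∀ ℓ, κ ℓ = 0 →
      cb (0, ℓ) ∈ (BettiUniverse.hodge hHD (AbelianVariety.isSmoothProjective_holds (A := A)) 1).piece 1 0 ∧
      cb (1, ℓ) ∈ (BettiUniverse.hodge hHD (AbelianVariety.isSmoothProjective_holds (A := A)) 1).piece 0 1)
    (hcb1 : ∀ ℓ, κ ℓ = 1 →
      cb (0, ℓ) ∈ (BettiUniverse.hodge hHD (AbelianVariety.isSmoothProjective_holds (A := A)) 1).piece 0 1 ∧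
      cb (1, ℓ) ∈ (BettiUniverse.hodge hHD (AbelianVariety.isSmoothProjective_holds (A := A)) 1).piece 1 0)
    (hdual : ∀ i j, ψ.form.baseChange ℂ (cb (0, i)) (cb (1, j)) = if i = j then 1 else 0)
    (hcross : ∀ j j' : Fin n, (∑ ℓ : Fin n₀, cupProduct (rfl : 1 + 1 = 2)
        (avLetters g (fun tl : Fin 2 × Fin n₀ =>
          ofRatClassBaseChange (Motives.ComplexPoints A.X) 1 (cb tl)) (j, ((0 : Fin 2), ℓ)))
        (avLetters g (fun tl : Fin 2 × Fin n₀ =>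
          ofRatClassBaseChange (Motives.ComplexPoints A.X) 1 (cb tl)) (j', ((1 : Fin 2), ℓ)))) ∈
      Submodule.span ℂ {c : complexBetti B.X 2 | IsRationalClass c ∧ IsOfHodgeType B.dim B.X 2 1 1 c})
    (p : ℕ) (c : complexBetti B.X (2 * p)) (hcQ : IsRationalClass c)
    (hc : IsOfHodgeType B.dim B.X (2 * p) p p c) :
    c ∈ divisorClassesSpan B.X B.dim p := by
  classical
  rcases Nat.eq_zero_or_pos p with rfl | hp
  · exact AbelianVariety.mem_divisorClassesSpan_zero B c
  obtain ⟨a, hca, hkill⟩ := hg.exists_unitaryInvariant_coeff_threeCoprime hHD hI ψ hφE hd hφ2 hE hμ h3b cb κ hcbW hcbW'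
    hcb0 hcb1 hdual hp hcQ hc
  set y : (Fin n × Fin 2) × Fin n₀ → complexBetti B.X 1 := fun x => avLetters g (fun tl : Fin 2 × Fin n₀ =>
    ofRatClassBaseChange (Motives.ComplexPoints A.X) 1 (cb tl)) (x.1.1, (x.1.2, x.2)) with hy
  set F := cupPowOneAlt ℂ (Motives.ComplexPoints B.X) (2 * p) with hF
  rw [← hca, wordEval_eq_sum_wordSlice]
  refine Submodule.sum_mem _ fun U _ => ?_
  -- Lie invariance ⟹ `GL(W)`-invariance ⟹ a combination of complete contractions (tensor FFT for `GL`)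
  set ty : Fin (2 * p) → Bool := fun t => decide ((U t).2 = 0) with hty
  have hLie : ∀ X : Matrix (Fin n₀) (Fin n₀) ℂ, wordDerAt ℂ (mixedLieFamily ty X) (wordSlice a U) = 0 := by
    intro X
    have hfam : mixedLieFamily ty X = fun t => if (U t).2 = 0 then X else -Xᵀ := by
      funext t
      simp only [mixedLieFamily, hty, decide_eq_true_eq]
    rw [hfam]
    exact hkill U X
  have hmem := mem_span_contractionTensor_of_forall_wordDerAt_mixedLieFamily_eq_zero ty hLie
  set Λ := Fintype.linearCombination ℂ (fun ε : Word n₀ (2 * p) => F (fun q => y (U q, ε q))) with hΛ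
  have hΛapply : ∀ cf : Word n₀ (2 * p) → ℂ, Λ cf = ∑ ε, cf ε • F (fun q => y (U q, ε q)) :=
    fun cf => Fintype.linearCombination_apply ℂ _ cf
  rw [← hΛapply]
  refine (Submodule.span_le (p := (divisorClassesSpan B.X B.dim p).comap Λ)).2 ?_ hmem
  rintro _ ⟨β, -, rfl⟩
  rw [SetLike.mem_coe, Submodule.mem_comap, hΛapply]
  -- evaluation of a complete contraction: `±` a product of crossed classes
  obtain ⟨π, eP, hsum⟩ := Milne1999.sum_contractionTensor_smul_eq F ty β y U
  rw [hsum]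
  refine Submodule.smul_mem _ _ ?_
  simp_rw [hF, cupPowOneAlt_apply]
  refine Milne1999.sum_cupPowOne_glPairWord_mem y p _ _ fun i => ?_
  have h0 : (U (eP.symm i : Fin (2 * p))).2 = 0 := by
    have h := (eP.symm i).2
    simpa [hty] using h
  have h1' : (U (β (eP.symm i) : Fin (2 * p))).2 = 1 := by
    have h := (β (eP.symm i)).2
    simp only [hty, decide_eq_false_iff_not] at h
    rcases Fin.eq_zero_or_eq_succ (U (β (eP.symm i) : Fin (2 * p))).2 with h' | ⟨j, hj⟩
    · exact absurd h' h
    · rw [hj, Fin.eq_zero j]; rfl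
  have hyU : ∀ (q : Fin (2 * p)) (ℓ : Fin n₀), y (U q, ℓ) = avLetters g (fun tl : Fin 2 × Fin n₀ =>
      ofRatClassBaseChange (Motives.ComplexPoints A.X) 1 (cb tl)) ((U q).1, ((U q).2, ℓ)) := fun q ℓ => rfl
  simp only [hyU, h0, h1']
  exact hcross _ _

/-- **`IsDivisorGenerated B`** (the tree's spelling of `B•(B) = D•(B) ⊗ ℂ`) for every abelian variety `B` with
slots over an abelian variety `A` carrying the unitary data of type `(m, 1)` and crossed classes in
`B¹ ⊗ ℂ`. [cite: Ribet1983, Thm. 0 and Thm. 3] [cite: Gordon1997, Thm. 6.3 (3)] -/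
theorem AVSlots.isDivisorGenerated_of_unitaryData_threeCoprime [HodgeTensorFacts.{0, 0}] (hg : AVSlots A B g)
    (hHD : exists_isReal_hodgeModel) (hI : hodgePQ_independent_of_hodgeModel)
    (ψ : (BettiUniverse.hodge hHD (AbelianVariety.isSmoothProjective_holds (A := A)) 1).Polarization)
    {φ : Module.End ℚ (bettiCohomology A.X 1)}
    (hφE : φ ∈ (BettiUniverse.hodge hHD (AbelianVariety.isSmoothProjective_holds (A := A)) 1).endAlg)
    {d : ℚ} (hd : 0 < d) (hφ2 : φ * φ = -(d • 1))
    (hE : ∀ a ∈ (BettiUniverse.hodge hHD (AbelianVariety.isSmoothProjective_holds (A := A)) 1).endAlg,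
      ∃ x y : ℚ, a = x • 1 + y • φ)
    {μ : ℂ} (hμ : μ ^ 2 = -(d : ℂ))
    (h3b : (Module.finrank ℂ ↥(Module.End.eigenspace (φ.baseChange ℂ) μ ⊓
        (BettiUniverse.hodge hHD (AbelianVariety.isSmoothProjective_holds (A := A)) 1).piece 1 0) = 3 ∧
      ¬ 3 ∣ Module.finrank ℂ ↥(Module.End.eigenspace (φ.baseChange ℂ) μ ⊓
        (BettiUniverse.hodge hHD (AbelianVariety.isSmoothProjective_holds (A := A)) 1).piece 0 1)) ∨
      (¬ 3 ∣ Module.finrank ℂ ↥(Module.End.eigenspace (φ.baseChange ℂ) μ ⊓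
        (BettiUniverse.hodge hHD (AbelianVariety.isSmoothProjective_holds (A := A)) 1).piece 1 0) ∧
      Module.finrank ℂ ↥(Module.End.eigenspace (φ.baseChange ℂ) μ ⊓
        (BettiUniverse.hodge hHD (AbelianVariety.isSmoothProjective_holds (A := A)) 1).piece 0 1) = 3))
    {n₀ : ℕ} (cb : Module.Basis (Fin 2 × Fin n₀) ℂ (ℂ ⊗[ℚ] bettiCohomology A.X 1)) (κ : Fin n₀ → Fin 2)
    (hcbW : ∀ ℓ, cb (0, ℓ) ∈ Module.End.eigenspace (φ.baseChange ℂ) μ)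
    (hcbW' : ∀ ℓ, cb (1, ℓ) ∈ Module.End.eigenspace (φ.baseChange ℂ) (-μ))
    (hcb0 : ∀ ℓ, κ ℓ = 0 →
      cb (0, ℓ) ∈ (BettiUniverse.hodge hHD (AbelianVariety.isSmoothProjective_holds (A := A)) 1).piece 1 0 ∧
      cb (1, ℓ) ∈ (BettiUniverse.hodge hHD (AbelianVariety.isSmoothProjective_holds (A := A)) 1).piece 0 1)
    (hcb1 : ∀ ℓ, κ ℓ = 1 →
      cb (0, ℓ) ∈ (BettiUniverse.hodge hHD (AbelianVariety.isSmoothProjective_holds (A := A)) 1).piece 0 1 ∧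
      cb (1, ℓ) ∈ (BettiUniverse.hodge hHD (AbelianVariety.isSmoothProjective_holds (A := A)) 1).piece 1 0)
    (hdual : ∀ i j, ψ.form.baseChange ℂ (cb (0, i)) (cb (1, j)) = if i = j then 1 else 0)
    (hcross : ∀ j j' : Fin n, (∑ ℓ : Fin n₀, cupProduct (rfl : 1 + 1 = 2)
        (avLetters g (fun tl : Fin 2 × Fin n₀ =>
          ofRatClassBaseChange (Motives.ComplexPoints A.X) 1 (cb tl)) (j, ((0 : Fin 2), ℓ)))
        (avLetters g (fun tl : Fin 2 × Fin n₀ =>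
          ofRatClassBaseChange (Motives.ComplexPoints A.X) 1 (cb tl)) (j', ((1 : Fin 2), ℓ)))) ∈
      Submodule.span ℂ {c : complexBetti B.X 2 | IsRationalClass c ∧ IsOfHodgeType B.dim B.X 2 1 1 c}) :
    IsDivisorGenerated B :=
  fun p c hcQ hc => hg.unitaryHodgeClasses_divisorial_threeCoprime hHD hI ψ hφE hd hφ2 hE hμ h3b cb κ hcbW hcbW' hcb0 hcb1
    hdual hcross p c hcQ hc

end Assembly

/-! ### §5 The unconditional assembly on an abelian variety of dimension `g`, `3 ∤ g`, of unitary type `(3, g − 3)` -/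

section CoprimeDim

variable {A B : AbelianVariety ℂ} {n : ℕ} {g : Fin n → (B ⟶ A)}

/-- **`B•(B) = D•(B) ⊗ ℂ` for every abelian variety `B` with slots over an `A` with `3 ∤ dim A` of Ribet type
`(3, dim A − 3)` — UNCONDITIONAL.** Hypotheses: `φ ≫ φ = -d`, `d > 0`, `finrank_ℚ End⁰(A) = 2`, `3 ∤ dim A`, and ONE of
the two multiplicities of `φ` (at `± i√d`) equal to `3` — the other is then `dim A − 3`, prime to `3`
(`eigenMultiplicity_add_eigenMultiplicity_neg_eq_dim`). Assembled exactly as `AVSlots.isDivisorGenerated_of_ribetTypeTwoThree`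
from `AVSlots.isDivisorGenerated_of_unitaryData_threeCoprime`, the adapted dual bases and the crossed classes.
[cite: Ribet1983, Thm. 0 and Thm. 3] [cite: Gordon1997, Thm. 6.3 (3) (p. 18)]
[cite: MoonenZarhin1999LowDim, §2 (2.4) and Thm. (2.7)] [cite: Milne1999LefschetzClasses, Prop. 3.3 and Prop. 3.6 (c)] -/
theorem AVSlots.isDivisorGenerated_of_ribetTypeThreeCoprime (hg : AVSlots A B g) (φ : A ⟶ A) {d : ℕ} (hd : 0 < d)
    (hφ : φ ≫ φ = -(d • 𝟙 A)) (hE2 : Module.finrank ℚ A.endAlgebra = 2) (h3dim : ¬ 3 ∣ A.dim)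
    (h3 : eigenMultiplicity A φ (Complex.I * (Real.sqrt d : ℂ)) = 3 ∨
      eigenMultiplicity A φ (-(Complex.I * (Real.sqrt d : ℂ))) = 3) :
    IsDivisorGenerated B := by
  classical
  have hHD : exists_isReal_hodgeModel := exists_isReal_hodgeModel_holds
  have hI : hodgePQ_independent_of_hodgeModel := hodgePQ_independent_of_hodgeModel_holds
  haveI : HodgeTensorFacts.{0, 0} := hodgeTensorFacts_holds.{0, 0}
  haveI : Module.Finite ℚ (bettiCohomology A.X 1) := finite_bettiCohomology_one A
  have hX : IsSmoothProjective A.dim A.X := AbelianVariety.isSmoothProjective_holds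
  -- a polarization of `H¹(A(ℂ); ℚ)`
  obtain ⟨ψ⟩ : (BettiUniverse.hodge hHD (AbelianVariety.isSmoothProjective_holds (A := A)) 1).IsPolarizable :=
    smoothProjective_hodgeStructure_isPolarizable_holds hX (BettiUniverse.realHodgeModel hHD hX)
      (BettiUniverse.realHodgeModel_isHodgeSymmetric hHD hX) 1
  have heff := BettiUniverse.hodge_isEffective hHD hX 1
  -- the rational datum `φ^*_ℚ`
  set φQ : Module.End ℚ (bettiCohomology A.X 1) := (bettiCohomology.map φ.hom.hom.hom 1).hom with hφQ
  have hφE : φQ ∈ (BettiUniverse.hodge hHD (AbelianVariety.isSmoothProjective_holds (A := A)) 1).endAlg := by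
    have h := unop_bettiRep_mem_endAlg hHD hI (AbelianVariety.endAlgebra.of A φ)
    rwa [bettiRep_of, MulOpposite.unop_op] at h
  have hφ2 : φQ * φQ = -((d : ℚ) • 1) := bettiMapHom_mul_self hφ
  have hdQ : (0 : ℚ) < d := Nat.cast_pos.2 hd
  -- `dim A ≥ 3` (one multiplicity is `3`)
  have hsum := eigenMultiplicity_add_eigenMultiplicity_neg_eq_dim A φ hd hφ
  have hdim2 : 3 ≤ A.dim := by rcases h3 with h | h <;> omega
  have hE := exists_eq_smul_one_add_smul_bettiMapHom hHD hI hd hφ hE2 (by omega)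
  -- the eigenvalue `μ = i√d` and the multiplicities `{3, dim A − 3}`
  set μ : ℂ := Complex.I * (Real.sqrt d : ℂ) with hμdef
  have hμ : μ ^ 2 = -((d : ℚ) : ℂ) := by
    rw [hμdef, mul_pow, Complex.I_sq, ← Complex.ofReal_pow, Real.sq_sqrt (Nat.cast_nonneg d),
      Complex.ofReal_natCast, Rat.cast_natCast, neg_one_mul]
  have hconj : starRingEnd ℂ μ = -μ := by
    rw [hμdef, map_mul, Complex.conj_I, Complex.conj_ofReal, neg_mul]
  have h3b : (Module.finrank ℂ ↥(Module.End.eigenspace (φQ.baseChange ℂ) μ ⊓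
        (BettiUniverse.hodge hHD (AbelianVariety.isSmoothProjective_holds (A := A)) 1).piece 1 0) = 3 ∧
      ¬ 3 ∣ Module.finrank ℂ ↥(Module.End.eigenspace (φQ.baseChange ℂ) μ ⊓
        (BettiUniverse.hodge hHD (AbelianVariety.isSmoothProjective_holds (A := A)) 1).piece 0 1)) ∨
      (¬ 3 ∣ Module.finrank ℂ ↥(Module.End.eigenspace (φQ.baseChange ℂ) μ ⊓
        (BettiUniverse.hodge hHD (AbelianVariety.isSmoothProjective_holds (A := A)) 1).piece 1 0) ∧
      Module.finrank ℂ ↥(Module.End.eigenspace (φQ.baseChange ℂ) μ ⊓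
        (BettiUniverse.hodge hHD (AbelianVariety.isSmoothProjective_holds (A := A)) 1).piece 0 1) = 3) := by
    rw [hφQ, finrank_eigenspace_inf_piece_oneZero_eq_eigenMultiplicity hHD hI φ μ,
      finrank_eigenspace_inf_piece_zeroOne_eq_eigenMultiplicity_conj hHD hI φ μ, hconj]
    rcases h3 with h | h
    · exact Or.inl ⟨h, fun h' => h3dim (by omega)⟩
    · exact Or.inr ⟨fun h' => h3dim (by omega), h⟩
  -- adapted dual bases
  obtain ⟨n₀, cb, κ, hcbW, hcbW', hcb0, hcb1, hdual⟩ := UnitaryTheta.exists_adaptedDualBasis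
    (BettiUniverse.hodge hHD (AbelianVariety.isSmoothProjective_holds (A := A)) 1) Nat.cast_one heff ψ hφE
    hdQ hφ2 hE hμ
  refine hg.isDivisorGenerated_of_unitaryData_threeCoprime hHD hI ψ hφE hdQ hφ2 hE hμ h3b cb κ hcbW hcbW' hcb0 hcb1
    hdual fun j j' => ?_
  -- the crossed classes are divisor classes
  have hθ := sum_cupH1_adaptedDualBasis_mem_span_rational_oneOne hHD hI ψ hφE hdQ hφ2 hE hμ cb κ hcbW hcbW'
    hcb0 hcb1 hdual
  simp only [cupH1_apply] at hθ
  obtain ⟨hμ0, -⟩ := UnitaryTheta.conj_eq_neg_of_sq hdQ hμ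
  have hne : μ ≠ -μ := fun h => hμ0 (by
    have h2 : (2 : ℂ) * μ = 0 := by rw [two_mul]; nth_rw 2 [h]; exact add_neg_cancel μ
    exact (mul_eq_zero.1 h2).resolve_left two_ne_zero)
  have he : ∀ i, VanGeemen1994.pullbackOne A φ (ofRatClassBaseChange (Motives.ComplexPoints A.X) 1 (cb (0, i))) =
      μ • ofRatClassBaseChange (Motives.ComplexPoints A.X) 1 (cb (0, i)) := fun i => by
    have h := congrArg (ofRatClassBaseChange (Motives.ComplexPoints A.X) 1)
      (Module.End.mem_eigenspace_iff.1 (hcbW i))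
    rw [hφQ, ofRatClassBaseChange_baseChange_bettiMapHom, map_smul] at h
    exact h
  have hf : ∀ i, VanGeemen1994.pullbackOne A φ (ofRatClassBaseChange (Motives.ComplexPoints A.X) 1 (cb (1, i))) =
      (-μ) • ofRatClassBaseChange (Motives.ComplexPoints A.X) 1 (cb (1, i)) := fun i => by
    have h := congrArg (ofRatClassBaseChange (Motives.ComplexPoints A.X) 1)
      (Module.End.mem_eigenspace_iff.1 (hcbW' i))
    rw [hφQ, ofRatClassBaseChange_baseChange_bettiMapHom, map_smul] at h
    exact h
  exact Milne1999.sum_cross_mem_span_rational_oneOne_of_eigen φ (g j) (g j')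
    (fun i => ofRatClassBaseChange (Motives.ComplexPoints A.X) 1 (cb (0, i)))
    (fun i => ofRatClassBaseChange (Motives.ComplexPoints A.X) 1 (cb (1, i))) hne he hf hθ

end CoprimeDim

/-- **Ribet 1983 Thm. 3 at `(3, g − 3)`, `3 ∤ g`, all powers — UNCONDITIONAL: `B•(A^{N+1}) = D•(A^{N+1}) ⊗ ℂ`** for a
complex abelian variety `A` with `3 ∤ dim A`, `φ ≫ φ = -d` (`d > 0`), `finrank_ℚ End⁰(A) = 2` and one multiplicity
of `φ` equal to `3` (the conclusion of the named fact `Ribet1983_hodgeClasses_divisorial_powers_imaginaryQuadraticCoprime`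
in this case, now a theorem). [cite: Ribet1983, Thm. 0 and Thm. 3] [cite: Gordon1997, Thm. 6.3 (3)]
[cite: MoonenZarhin1999LowDim, §2 (2.4) and Thm. (2.7)] -/
theorem AbelianVariety.isDivisorGenerated_powSucc_of_ribetTypeThreeCoprime (A : AbelianVariety ℂ) (φ : A ⟶ A)
    {d : ℕ} (hd : 0 < d) (hφ : φ ≫ φ = -(d • 𝟙 A)) (hE2 : Module.finrank ℚ A.endAlgebra = 2) (h3dim : ¬ 3 ∣ A.dim)
    (h3 : eigenMultiplicity A φ (Complex.I * (Real.sqrt d : ℂ)) = 3 ∨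
      eigenMultiplicity A φ (-(Complex.I * (Real.sqrt d : ℂ))) = 3) (N : ℕ) :
    IsDivisorGenerated (A.powSucc N) :=
  (AVSlots.powSucc A N).isDivisorGenerated_of_ribetTypeThreeCoprime φ hd hφ hE2 h3dim h3

/-- `A` itself: `B•(A) = D•(A) ⊗ ℂ` for `A` with `3 ∤ dim A` of Ribet type `(3, dim A − 3)`. [cite: Ribet1983, Thm. 3]
[cite: MoonenZarhin1999LowDim, §2 (2.4)] -/
theorem AbelianVariety.isDivisorGenerated_of_ribetTypeThreeCoprime (A : AbelianVariety ℂ) (φ : A ⟶ A)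
    {d : ℕ} (hd : 0 < d) (hφ : φ ≫ φ = -(d • 𝟙 A)) (hE2 : Module.finrank ℚ A.endAlgebra = 2) (h3dim : ¬ 3 ∣ A.dim)
    (h3 : eigenMultiplicity A φ (Complex.I * (Real.sqrt d : ℂ)) = 3 ∨
      eigenMultiplicity A φ (-(Complex.I * (Real.sqrt d : ℂ))) = 3) :
    IsDivisorGenerated A :=
  (avSlots_self A).isDivisorGenerated_of_ribetTypeThreeCoprime φ hd hφ hE2 h3dim h3

/-- **The Hodge conjecture for all powers `A^{N+1}` of an abelian variety with `3 ∤ dim A` of Ribet type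
`(3, dim A − 3)` — UNCONDITIONAL** (`B = D` with Lefschetz `(1,1)`, the tree's `hodgeConjectureFor_of_isDivisorGenerated`).
[cite: Ribet1983, Thm. 3] [cite: vanGeemen1994HodgeAV, §2.4] [cite: Deligne2000, §1] -/
theorem hodgeConjectureFor_powSucc_of_ribetTypeThreeCoprime (A : AbelianVariety ℂ) (φ : A ⟶ A)
    {d : ℕ} (hd : 0 < d) (hφ : φ ≫ φ = -(d • 𝟙 A)) (hE2 : Module.finrank ℚ A.endAlgebra = 2) (h3dim : ¬ 3 ∣ A.dim)
    (h3 : eigenMultiplicity A φ (Complex.I * (Real.sqrt d : ℂ)) = 3 ∨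
      eigenMultiplicity A φ (-(Complex.I * (Real.sqrt d : ℂ))) = 3) (N : ℕ) :
    HodgeConjectureFor (A.powSucc N).dim (A.powSucc N).X :=
  hodgeConjectureFor_of_isDivisorGenerated _
    (AbelianVariety.isDivisorGenerated_powSucc_of_ribetTypeThreeCoprime A φ hd hφ hE2 h3dim h3 N)

/-! ### §6 Dimension seven: the signatures `(3,4)` and `(4,3)` (simple abelian sevenfolds of Type IV(1), Moonen–Zarhin (2.7)) -/

/-- **`B•(A^{N+1}) = D•(A^{N+1}) ⊗ ℂ` for an abelian SEVENFOLD with `End⁰(A) = k` imaginary quadratic acting with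
multiplicities `(3,4)` or `(4,3)`** — UNCONDITIONAL (with the tree's type-one theorem `(6,1)`/`(1,6)` and the `(2,5)`/`(5,2)`
theorem of `RibetTypeTwoOddPowersHodgeClasses`, EVERY Type IV(1) signature of dimension `7` is now covered).
[cite: Ribet1983, Thm. 3] [cite: MoonenZarhin1999LowDim, Thm. (2.7)] [cite: Gordon1997, Thm. 6.3 (3) and Corollary] -/
theorem AbelianVariety.isDivisorGenerated_powSucc_of_sevenfold_threeFour (A : AbelianVariety ℂ) (φ : A ⟶ A)
    {d : ℕ} (hd : 0 < d) (hφ : φ ≫ φ = -(d • 𝟙 A)) (hE2 : Module.finrank ℚ A.endAlgebra = 2) (hdim : A.dim = 7)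
    (h3 : eigenMultiplicity A φ (Complex.I * (Real.sqrt d : ℂ)) = 3 ∨
      eigenMultiplicity A φ (-(Complex.I * (Real.sqrt d : ℂ))) = 3) (N : ℕ) :
    IsDivisorGenerated (A.powSucc N) :=
  AbelianVariety.isDivisorGenerated_powSucc_of_ribetTypeThreeCoprime A φ hd hφ hE2 (by rw [hdim]; omega) h3 N

/-- **The Hodge conjecture for all powers of an abelian SEVENFOLD of unitary type `(3,4)` / `(4,3)` — UNCONDITIONAL.**
[cite: Ribet1983, Thm. 3] [cite: MoonenZarhin1999LowDim, Thm. (2.7)] [cite: Deligne2000, §1] -/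
theorem hodgeConjectureFor_powSucc_of_sevenfold_threeFour (A : AbelianVariety ℂ) (φ : A ⟶ A)
    {d : ℕ} (hd : 0 < d) (hφ : φ ≫ φ = -(d • 𝟙 A)) (hE2 : Module.finrank ℚ A.endAlgebra = 2) (hdim : A.dim = 7)
    (h3 : eigenMultiplicity A φ (Complex.I * (Real.sqrt d : ℂ)) = 3 ∨
      eigenMultiplicity A φ (-(Complex.I * (Real.sqrt d : ℂ))) = 3) (N : ℕ) :
    HodgeConjectureFor (A.powSucc N).dim (A.powSucc N).X :=
  hodgeConjectureFor_of_isDivisorGenerated _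
    (AbelianVariety.isDivisorGenerated_powSucc_of_sevenfold_threeFour A φ hd hφ hE2 hdim h3 N)

end Literature.AlgebraicGeometry.HodgeTheory

end
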